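import Mathlib
import HarnessLib
import Summits.NavierStokesRegularity.NavierStokesRegularity.Theses.ThreadingFlux
import Summits.NavierStokesRegularity.NavierStokesRegularity.Theses.UnthreadedDoor
import Summits.NavierStokesRegularity.NavierStokesRegularity.Theorems.LiouvilleConjectureNS
import Summits.NavierStokesRegularity.NavierStokesRegularity.Theorems.UnthreadedDoorAntidynamoWallIffCrux

/-!
# Route `UnthreadedDoor` / `ThreadingFlux`, crux `PoloidalLiouville` (stmt-NavierStokesRegularity-1222), antidynamo v2 skeleton
# (sha16 `4ebf5683127b`): the crux and its WALL `StubScalarLiouville` sit BELOW the KNSS Liouville conjecture (L) — CONDITIONAL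
# bridges (ladder placement, by name); nothing is closed by this file

Support file (seat leafhand-ns-unthreadeddoor-3 g1, cell decomp-ns), `--supports stmt-NavierStokesRegularity-1222 --as helper`; theorems only.

The crux quantifies over bounded ancient mild solutions (`ν = 1`, duality class `IsBoundedAncientMildSolution 1 v`) with measurable
slices, jointly smooth on `(−∞,0) × ℝ³`, unthreaded about one centre.  Under the Liouville conjecture (L) of Koch–Nadirashvili–Seregin–Šverák
— canonical obligation `Summit.NavierStokesRegularity.NavierStokesRegularity.LiouvilleConjectureNS`, item stmt-NavierStokesRegularity-10661 —
every slice of such a `v` is a.e. constant; a jointly smooth field has continuous slices, so the slice IS that constant everywhere.  The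
unthreadedness hypothesis is not used.  Hence, kernel-checked:

* `poloidalLiouville_of_liouvilleConjectureNS  : LiouvilleConjectureNS → Theses.ThreadingFlux.PoloidalLiouville`;
* `poloidalLiouville_of_liouvilleConjectureNS' : LiouvilleConjectureNS → Theses.UnthreadedDoor.PoloidalLiouville` (token-identical decl);
* `stubScalarLiouville_of_liouvilleConjectureNS : LiouvilleConjectureNS → StubScalarLiouville` — the only active registered stub (the WALL,
  ⟺ crux by `stubScalarLiouville_iff_poloidalLiouville'`, p821616) is below (L) as well.

These are `conditional-result`s (hypothesis = an open conjecture); they record the dependency 1222 ⇐ (L) = 10661 by name, as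
`…PoloidalWindowDoorOfLiouville` does for 19708/20428 and `…SqueezeCycleExtremalBiaxialitySubcriticalOfLiouville` for 11609.  The crux is the
UNTHREADED SLICE of (L): (L) restricted to the NS-invariant-in-the-class condition `⟪x − x₀, curl v⟫ ≡ 0`; its zonal sub-slice is KNSS 2009
Thm 5.2 (tree `Literature.Analysis.FluidPDE.knss_axisymmetric_no_swirl'_holds`).

WHAT THIS IS NOT: not a proof of the crux or of the wall (both OPEN in print beyond axisymmetry), not a statement about Navier–Stokes
regularity (Clay A OPEN; (L) OPEN); no summit statement is proved.
[cite: KochNadirashviliSereginSverak2009, §1 conjecture (L); Thm 5.2 (arXiv:0709.3599 pp. 9–10)]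
-/

noncomputable section

-- the summit and its single sub-problem share the name (CONVENTIONS §1), as in every Theorems file
set_option linter.dupNamespace false

namespace Summit.NavierStokesRegularity.NavierStokesRegularity.Theorems.PoloidalLiouville.Antidynamo

open MeasureTheory Set Function
open scoped RealInnerProductSpace InnerProductSpace
open Literature.Analysis Literature.Analysis.FluidPDE
open Summit.NavierStokesRegularity.NavierStokesRegularity (LiouvilleConjectureNS)

/-- **Slices of the crux's class are constant under (L).**  A bounded ancient mild solution (`ν = 1`) with measurable slices that is
jointly smooth on `(−∞,0) × ℝ³` has, under the KNSS Liouville conjecture, spatially constant slices EVERYWHERE (not only a.e.): (L) gives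
`v t = b` a.e., the slice `v t = (uncurry v) ∘ (t, ·)` is continuous, and two continuous functions that agree a.e. for Lebesgue measure
agree.  CONDITIONAL on the open conjecture `LiouvilleConjectureNS`. [cite: KochNadirashviliSereginSverak2009, §1 conjecture (L)] -/
theorem slice_const_of_liouvilleConjectureNS (hL : LiouvilleConjectureNS)
    (v : ℝ → EuclideanSpace ℝ (Fin 3) → EuclideanSpace ℝ (Fin 3))
    (hB : IsBoundedAncientMildSolution 1 v) (hm : ∀ t < 0, AEStronglyMeasurable (v t) volume)
    (hsm : ContDiffOn ℝ (⊤ : ℕ∞) (Function.uncurry v) (Set.Iio 0 ×ˢ Set.univ)) :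
    ∀ t < 0, ∃ b : EuclideanSpace ℝ (Fin 3), ∀ x, v t x = b := by
  intro t ht
  obtain ⟨b, hb⟩ := hL v hB hm t ht
  refine ⟨b, fun x => ?_⟩
  have hvt : Continuous (v t) :=
    hsm.continuousOn.comp_continuous (continuous_const.prodMk continuous_id) fun _ => ⟨ht, mem_univ _⟩
  exact congr_fun ((Continuous.ae_eq_iff_eq volume hvt continuous_const).1 hb) x

/-- **Crux 1222 `PoloidalLiouville` (`ThreadingFlux` decl) from the Liouville conjecture (L)** (conditional bridge).  The crux is the
unthreaded slice of (L); the hypothesis `⟪x − x₀, curl v⟫ ≡ 0` is simply dropped. [cite: KochNadirashviliSereginSverak2009, §1 conjecture (L)] -/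
theorem poloidalLiouville_of_liouvilleConjectureNS (hL : LiouvilleConjectureNS) :
    Summit.NavierStokesRegularity.NavierStokesRegularity.Theses.ThreadingFlux.PoloidalLiouville :=
  fun v hB hm hsm _hx => slice_const_of_liouvilleConjectureNS hL v hB hm hsm

/-- **Crux 1222 `PoloidalLiouville` (`UnthreadedDoor` decl, token-identical) from (L)** (conditional bridge).
[cite: KochNadirashviliSereginSverak2009, §1 conjecture (L)] -/
theorem poloidalLiouville_of_liouvilleConjectureNS' (hL : LiouvilleConjectureNS) :
    Summit.NavierStokesRegularity.NavierStokesRegularity.Theses.UnthreadedDoor.PoloidalLiouville :=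
  poloidalLiouville_of_liouvilleConjectureNS hL

/-- **The WALL `StubScalarLiouville` (the only active registered stub of skeleton `4ebf5683127b`) from (L)** (conditional bridge):
(L) ⟹ crux ⟹ wall, the second arrow being `stubScalarLiouville_of_poloidalLiouville'` (WALL ⟺ CRUX, p821616).  So the ladder reads
`(L) = 10661 ⟹ 1222 ⟺ StubScalarLiouville ⊋ KNSS Thm 5.2 (zonal, proved)`. [cite: KochNadirashviliSereginSverak2009, §1 conjecture (L); Thm 5.2] -/
theorem stubScalarLiouville_of_liouvilleConjectureNS (hL : LiouvilleConjectureNS) : StubScalarLiouville :=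
  stubScalarLiouville_of_poloidalLiouville' (poloidalLiouville_of_liouvilleConjectureNS' hL)

end Summit.NavierStokesRegularity.NavierStokesRegularity.Theorems.PoloidalLiouville.Antidynamo

end
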